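import Mathlib
import Literature.NumberTheory.LFunctions.Zhang2022.AppendixBTailB3Contour
import HarnessLib

/-!
# Zhang (2022), Appendix B: the ratio `ζ(1+s)/ζ(1+s−β_j)` on a Landau box (reusable bounds)

Topic `Literature/NumberTheory/LFunctions/Zhang2022` (Landau–Siegel audit tree; verdict-neutral).
Y. Zhang, *Discrete mean estimates and the Landau–Siegel zero*, arXiv:2211.02515v1 (2022)
[Zhang2022LandauSiegel] — **an unrefereed manuscript under adjudication; nothing here asserts or
denies its Theorems 1–2.** Appendix B (pp. 106–108): every contour step of the proof of Lemma 15.1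
(`Z22:§B.u009`, `u012`, `u015`, the `μ = 1, 2, 3` evaluations) moves a line integral of
`ζ(1+s)ζ(1+s−β_j)⁻¹ × (Gaussian Perron kernel)` from `Re s = 1` to the left "in a way similar to the
proof of Lemma 8.4", i.e. over Landau's rectangle inside the classical zero-free region. This file
packages, ONCE, the analytic input common to all of them: for a purely imaginary shift `β = ib`,
`|b| ≤ 1`, and a height `H ≥ 2`, with `η = 2c̄/log(H+5)`:

* the HOLOMORPHIC version `Φ_b(z) = ζ(1+z)(z−ib)/ζ₁(1+z−ib)` of the ratio (`ζ₁` = Mathlib's entire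
  `riemannZeta₁ = (w−1)ζ(w)`; NOTE: the quotient `ζ(1+z)/ζ(1+z−ib)` of Mathlib VALUES is not continuous
  at `z = ib`, where `ζ(1)` is a junk value — `Φ_b` is the function the source means, and equals the
  quotient off `z = ib`, `Phi_eq_div_of_ne`);
* `ζ₁(1+z−ib) ≠ 0` on `U = {−2η < Re z, |Im z| < H+1}` and differentiability of `Φ_b` on `U ∖ {0}`;
* the three sup bounds: `|Φ_b| ≤ 4` on `Re z = 1`; `|Φ_b| ≤ (1/η + C log(H+5))·C log(H+5)` on
  `Re z = −η, |Im z| ≤ H`; `|Φ_b| ≤ (1 + C log(H+5))·C log(H+5)` on `Im z = ±H, −η ≤ Re z ≤ 1`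
  (`c̄, C` from `ZetaClassicalRegion.exists_zeroFreeRegion_bounds`).

These are exactly the hypotheses `hΦ₀/hΦ₁/hΦ₂/hG` of the tree engine
`GaussKernelContour.norm_lineIntegral_sub_sum_limUnder_le` (used at `H = 𝓛³⁰` in
`AppendixBTailB3Contour.lineIntegral_sub_residues_le`). No claim about Lemma 15.1, Theorems 1–2 of the
source or about Landau–Siegel zeros is made.

## References

* Y. Zhang, arXiv:2211.02515v1 (2022), App. B pp. 106–108; §8 proof of Lemma 8.2 p. 44.
  [cite: Zhang2022LandauSiegel, App. B p.108]
* H. L. Montgomery, R. C. Vaughan, *Multiplicative Number Theory I*, CUP 2007, §6.2, Thm 6.7.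
  [cite: MontgomeryVaughan2007, §6.2]
-/

noncomputable section

open Complex Real Set Filter Topology

namespace Literature.NumberTheory.LFunctions.Zhang2022.AppendixBVarrho

/-- Off `z = ib` the holomorphic ratio IS the quotient of values: `ζ(1+z)(z−ib)/ζ₁(1+z−ib) =
ζ(1+z)·ζ(1+z−ib)⁻¹`. [cite: Titchmarsh1986, §2.1 eq. (2.1.16)] -/
theorem Phi_eq_div_of_ne {z β : ℂ} (hz : z ≠ β) :
    riemannZeta (1 + z) * ((z - β) / riemannZeta₁ (1 + z - β)) =
      riemannZeta (1 + z) * (riemannZeta (1 + z - β))⁻¹ := by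
  have hw : 1 + z - β ≠ 1 := by
    intro h; apply hz; linear_combination h
  rw [inv_riemannZeta_eq_div_zeta₁ hw]
  congr 2
  ring

/-- **The ratio `ζ(1+s)/ζ(1+s−ib)` on Landau's box** (`|b| ≤ 1`, height `H ≥ 2`, `η = 2c̄/log(H+5)`,
`ℓ = log(H+5)`; `c̄ ≤ 1/100`, `C` the constants of the classical zero-free region
`ZetaClassicalRegion.exists_zeroFreeRegion_bounds`): with `Φ(z) = ζ(1+z)(z−ib)/ζ₁(1+z−ib)`,
(0) `0 < η < 1`; (1) `ζ₁(1+z−ib) ≠ 0` for `−2η < Re z`, `|Im z| < H+1`; (2) `Φ` is differentiable at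
every `z ≠ 0` with `ζ₁(1+z−ib) ≠ 0`; (3) `t ↦ Φ(1+it)` is continuous and `|Φ(1+it)| ≤ 4`;
(4) `|Φ(−η+it)| ≤ (1/η + Cℓ)·Cℓ` for `|t| ≤ H`; (5) `|Φ(u ± iH)| ≤ (1 + Cℓ)·Cℓ` for `−η ≤ u ≤ 1`.
[cite: Zhang2022LandauSiegel, App. B p.108] [cite: MontgomeryVaughan2007, §6.2] -/
theorem zetaRatio_landauBox : ∃ cb : ℝ, 0 < cb ∧ cb ≤ 1 / 100 ∧ ∃ C : ℝ, 0 < C ∧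
    ∀ (H : ℝ), 2 ≤ H → ∀ (b : ℝ), |b| ≤ 1 → ∀ (η ℓ : ℝ), ℓ = Real.log (H + 5) → η = 2 * cb / ℓ →
      (0 < η ∧ η < 1) ∧
      (∀ z : ℂ, -(2 * η) < z.re → |z.im| < H + 1 → riemannZeta₁ (1 + z - b * I) ≠ 0) ∧
      (∀ z : ℂ, z ≠ 0 → riemannZeta₁ (1 + z - b * I) ≠ 0 →
        DifferentiableAt ℂ (fun z : ℂ => riemannZeta (1 + z) * ((z - b * I) / riemannZeta₁ (1 + z - b * I))) z) ∧
      (Continuous fun t : ℝ => riemannZeta (1 + (((1 : ℝ) : ℂ) + t * I)) *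
          (((((1 : ℝ) : ℂ) + t * I) - b * I) / riemannZeta₁ (1 + (((1 : ℝ) : ℂ) + t * I) - b * I))) ∧
      (∀ t : ℝ, ‖riemannZeta (1 + (((1 : ℝ) : ℂ) + t * I)) *
          (((((1 : ℝ) : ℂ) + t * I) - b * I) / riemannZeta₁ (1 + (((1 : ℝ) : ℂ) + t * I) - b * I))‖ ≤ 4) ∧
      (∀ t : ℝ, |t| ≤ H → ‖riemannZeta (1 + (((-η : ℝ) : ℂ) + t * I)) *
          (((((-η : ℝ) : ℂ) + t * I) - b * I) / riemannZeta₁ (1 + (((-η : ℝ) : ℂ) + t * I) - b * I))‖ ≤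
            (1 / η + C * ℓ) * (C * ℓ)) ∧
      (∀ u : ℝ, -η ≤ u → u ≤ 1 → ∀ T' : ℝ, |T'| = H → ‖riemannZeta (1 + ((u : ℂ) + (T' : ℂ) * I)) *
          ((((u : ℂ) + (T' : ℂ) * I) - b * I) / riemannZeta₁ (1 + ((u : ℂ) + (T' : ℂ) * I) - b * I))‖ ≤
            (1 + C * ℓ) * (C * ℓ)) := by
  obtain ⟨cb, hcb0, hcb1, C, hC0, hZ⟩ := ZetaClassicalRegion.exists_zeroFreeRegion_bounds
  refine ⟨cb, hcb0, hcb1, C, hC0, ?_⟩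
  intro H hH b hb η ℓ hℓ hη
  set βj : ℂ := (b : ℂ) * I with hβjdef
  have hβjre : βj.re = 0 := by simp [hβjdef]
  have hβjim : βj.im = b := by simp [hβjdef]
  -- `ℓ`, `η`
  have hℓ5 : Real.log 5 ≤ ℓ := by
    rw [hℓ]; exact Real.log_le_log (by norm_num) (by linarith)
  have hlog5 : (1 : ℝ) < Real.log 5 := by
    rw [Real.lt_log_iff_exp_lt (by norm_num)]
    have := Real.exp_one_lt_d9; linarith
  have hℓ1 : 1 < ℓ := lt_of_lt_of_le hlog5 hℓ5
  have hℓ0 : 0 < ℓ := by linarith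
  have hη0 : 0 < η := by rw [hη]; positivity
  have hη1 : η < 1 := by
    rw [hη, div_lt_one hℓ0]
    calc 2 * cb ≤ 2 * (1 / 100) := by gcongr
      _ < 1 := by norm_num
      _ < ℓ := hℓ1
  -- the zero-free-region package at height `≤ H + 2`
  have hzfr_of : ∀ w : ℂ, w ≠ 1 → |w.im| ≤ H + 2 → 1 - 2 * η ≤ w.re →
      riemannZeta w ≠ 0 ∧ ‖riemannZeta w - 1 / (w - 1)‖ ≤ C * ℓ ∧ ‖(riemannZeta w)⁻¹‖ ≤ C * ℓ := by
    intro w hw1 hwim hwre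
    have hlogle : Real.log (|w.im| + 3) ≤ ℓ := by
      rw [hℓ]; exact Real.log_le_log (by positivity) (by linarith)
    have hlogpos : 0 < Real.log (|w.im| + 3) := Real.log_pos (by linarith [abs_nonneg w.im])
    have hcond : 1 - 4 * cb / Real.log (|w.im| + 3) ≤ w.re := by
      have h1 : 4 * cb / ℓ ≤ 4 * cb / Real.log (|w.im| + 3) :=
        div_le_div_of_nonneg_left (by positivity) hlogpos hlogle
      have h2 : 2 * η = 4 * cb / ℓ := by rw [hη]; ring
      linarith
    obtain ⟨hne, hsub, hinv, -⟩ := hZ w hw1 hcond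
    refine ⟨hne, hsub.trans ?_, hinv.trans ?_⟩ <;>
      exact mul_le_mul_of_nonneg_left hlogle hC0.le
  obtain ⟨Φ, hΦdef⟩ : ∃ Φ : ℂ → ℂ, Φ = fun z => riemannZeta (1 + z) *
    ((z - βj) / riemannZeta₁ (1 + z - βj)) := ⟨_, rfl⟩
  have hnormΦ : ∀ z : ℂ, z ≠ βj →
      ‖Φ z‖ = ‖riemannZeta (1 + z)‖ * ‖(riemannZeta (1 + z - βj))⁻¹‖ := by
    intro z hz
    rw [hΦdef]; dsimp only
    rw [Phi_eq_div_of_ne hz, norm_mul]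
  -- (1) `ζ₁ ≠ 0` on `U`
  have hζ₁U : ∀ z : ℂ, -(2 * η) < z.re → |z.im| < H + 1 → riemannZeta₁ (1 + z - βj) ≠ 0 := by
    intro z hz1 hz2
    refine riemannZeta₁_ne_zero_of fun hw => ?_
    have him : |(1 + z - βj).im| ≤ H + 2 := by
      have : (1 + z - βj).im = z.im - b := by simp [hβjim]
      rw [this]
      calc |z.im - b| ≤ |z.im| + |b| := abs_sub _ _
        _ ≤ (H + 1) + 1 := add_le_add hz2.le hb
        _ = H + 2 := by ring
    have hre : 1 - 2 * η ≤ (1 + z - βj).re := by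
      have : (1 + z - βj).re = 1 + z.re := by simp [hβjre]
      rw [this]; linarith
    exact (hzfr_of _ hw him hre).1
  -- (2) differentiability
  have hΦdiff : ∀ z : ℂ, z ≠ 0 → riemannZeta₁ (1 + z - βj) ≠ 0 → DifferentiableAt ℂ Φ z := by
    intro z hz0 hζ
    have h1 : DifferentiableAt ℂ (fun z : ℂ => riemannZeta (1 + z)) z := by
      have h := differentiableAt_riemannZeta (s := 1 + z) (by intro h; apply hz0; linear_combination h)
      exact h.comp z (by fun_prop)
    have h2 : DifferentiableAt ℂ (fun z : ℂ => riemannZeta₁ (1 + z - βj)) z :=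
      (differentiable_riemannZeta₁.differentiableAt).comp z
        ((differentiableAt_id.const_add (1 : ℂ)).sub_const βj)
    have h3 : DifferentiableAt ℂ (fun z : ℂ => (z - βj) / riemannZeta₁ (1 + z - βj)) z :=
      (differentiableAt_id.sub_const βj).div h2 hζ
    rw [hΦdef]
    exact h1.mul h3
  -- (3) the line `Re z = 1`
  have hline_ne : ∀ t : ℝ, (((1 : ℝ) : ℂ) + t * I) ≠ βj := by
    intro t h; have := congrArg Complex.re h; simp [hβjre] at this
  have hζ₁line : ∀ t : ℝ, riemannZeta₁ (1 + (((1 : ℝ) : ℂ) + t * I) - βj) ≠ 0 := by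
    intro t
    refine riemannZeta₁_ne_zero_of fun _ => riemannZeta_ne_zero_of_one_le_re ?_
    simp [hβjre]
  have hΦcont : Continuous fun t : ℝ => Φ (((1 : ℝ) : ℂ) + t * I) := by
    have hl : Continuous fun t : ℝ => (((1 : ℝ) : ℂ) + t * I) := by fun_prop
    refine continuous_iff_continuousAt.mpr fun t => ?_
    have hz0 : (((1 : ℝ) : ℂ) + t * I) ≠ 0 := by
      intro h; have := congrArg Complex.re h; simp at this
    exact ContinuousAt.comp (g := Φ) (f := fun t : ℝ => (((1 : ℝ) : ℂ) + t * I))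
      (hΦdiff _ hz0 (hζ₁line t)).continuousAt hl.continuousAt
  have hΦ₀ : ∀ t : ℝ, ‖Φ (((1 : ℝ) : ℂ) + t * I)‖ ≤ 4 := by
    intro t
    rw [hnormΦ _ (hline_ne t)]
    have hre1 : (1 + (((1 : ℝ) : ℂ) + t * I)).re = 2 := by simp; norm_num
    have hre2 : (1 + (((1 : ℝ) : ℂ) + t * I) - βj).re = 2 := by simp [hβjre]; norm_num
    have b1 := (norm_zeta_and_inv_le_two hre1).1
    have b2 := (norm_zeta_and_inv_le_two hre2).2
    calc ‖riemannZeta (1 + (((1 : ℝ) : ℂ) + t * I))‖ * ‖(riemannZeta (1 + (((1 : ℝ) : ℂ) + t * I) - βj))⁻¹‖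
        ≤ 2 * 2 := mul_le_mul b1 b2 (norm_nonneg _) (by norm_num)
      _ = 4 := by norm_num
  -- (4) the left line `Re z = −η`, `|t| ≤ H`
  have hΦ₁ : ∀ t : ℝ, |t| ≤ H → ‖Φ (((-η : ℝ) : ℂ) + t * I)‖ ≤ (1 / η + C * ℓ) * (C * ℓ) := by
    intro t ht
    have hne : (((-η : ℝ) : ℂ) + t * I) ≠ βj := by
      intro h; have := congrArg Complex.re h; simp [hβjre] at this; linarith
    rw [hnormΦ _ hne]
    set w₁ : ℂ := 1 + (((-η : ℝ) : ℂ) + t * I) with hw₁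
    have hw₁1 : w₁ ≠ 1 := by
      intro h; have := congrArg Complex.re h; simp [hw₁] at this; linarith
    have hw₁im : |w₁.im| ≤ H + 2 := by
      have : w₁.im = t := by simp [hw₁]
      rw [this]; linarith
    have hw₁re : 1 - 2 * η ≤ w₁.re := by
      have : w₁.re = 1 - η := by simp [hw₁]; ring
      rw [this]; linarith
    obtain ⟨-, hsub₁, -⟩ := hzfr_of w₁ hw₁1 hw₁im hw₁re
    have hnum : ‖riemannZeta w₁‖ ≤ 1 / η + C * ℓ := by
      have h1 : ‖(1 : ℂ) / (w₁ - 1)‖ ≤ 1 / η := by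
        have hw : w₁ - 1 = (((-η : ℝ) : ℂ) + t * I) := by rw [hw₁]; ring
        rw [hw, norm_div, norm_one]
        apply div_le_div_of_nonneg_left zero_le_one hη0
        calc η = |(((-η : ℝ) : ℂ) + t * I).re| := by simp [abs_of_pos hη0]
          _ ≤ ‖(((-η : ℝ) : ℂ) + t * I)‖ := Complex.abs_re_le_norm _
      calc ‖riemannZeta w₁‖ = ‖(riemannZeta w₁ - 1 / (w₁ - 1)) + 1 / (w₁ - 1)‖ := by ring_nf
        _ ≤ ‖riemannZeta w₁ - 1 / (w₁ - 1)‖ + ‖(1 : ℂ) / (w₁ - 1)‖ := norm_add_le _ _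
        _ ≤ C * ℓ + 1 / η := add_le_add hsub₁ h1
        _ = 1 / η + C * ℓ := by ring
    set w₂ : ℂ := 1 + (((-η : ℝ) : ℂ) + t * I) - βj with hw₂
    have hw₂1 : w₂ ≠ 1 := by
      intro h; have := congrArg Complex.re h; simp [hw₂, hβjre] at this; linarith
    have hw₂im : |w₂.im| ≤ H + 2 := by
      have : w₂.im = t - b := by simp [hw₂, hβjim]
      rw [this]
      calc |t - b| ≤ |t| + |b| := abs_sub _ _
        _ ≤ H + 1 := add_le_add ht hb
        _ ≤ H + 2 := by linarith
    have hw₂re : 1 - 2 * η ≤ w₂.re := by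
      have : w₂.re = 1 - η := by simp [hw₂, hβjre]; ring
      rw [this]; linarith
    obtain ⟨-, -, hinv₂⟩ := hzfr_of w₂ hw₂1 hw₂im hw₂re
    exact mul_le_mul hnum hinv₂ (norm_nonneg _) (by positivity)
  -- (5) the horizontal segments `Im z = ±H`, `Re z ∈ [−η, 1]`
  have hH1 : 1 ≤ H := by linarith
  have hΦ₂ : ∀ u : ℝ, -η ≤ u → u ≤ 1 → ∀ T' : ℝ, |T'| = H →
      ‖Φ ((u : ℂ) + (T' : ℂ) * I)‖ ≤ (1 + C * ℓ) * (C * ℓ) := by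
    intro u hu1 hu2 T' hT'
    have hne : ((u : ℂ) + (T' : ℂ) * I) ≠ βj := by
      intro h; have := congrArg Complex.im h; simp [hβjim] at this
      have : |b| = H := by rw [← this, hT']
      linarith
    rw [hnormΦ _ hne]
    set w₁ : ℂ := 1 + ((u : ℂ) + (T' : ℂ) * I) with hw₁
    have hw₁1 : w₁ ≠ 1 := by
      intro h; have := congrArg Complex.im h; simp [hw₁] at this
      rw [this, abs_zero] at hT'; linarith
    have hw₁im : |w₁.im| ≤ H + 2 := by
      have : w₁.im = T' := by simp [hw₁]
      rw [this, hT']; linarith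
    have hw₁re : 1 - 2 * η ≤ w₁.re := by
      have : w₁.re = 1 + u := by simp [hw₁]
      rw [this]; linarith
    obtain ⟨-, hsub₁, -⟩ := hzfr_of w₁ hw₁1 hw₁im hw₁re
    have hnum : ‖riemannZeta w₁‖ ≤ 1 + C * ℓ := by
      have h1 : ‖(1 : ℂ) / (w₁ - 1)‖ ≤ 1 := by
        have hw : w₁ - 1 = ((u : ℂ) + (T' : ℂ) * I) := by rw [hw₁]; ring
        rw [hw, norm_div, norm_one, div_le_one (norm_pos_iff.mpr (by
          intro h; have := congrArg Complex.im h; simp at this; rw [this, abs_zero] at hT'; linarith))]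
        calc (1 : ℝ) ≤ H := hH1
          _ = |((u : ℂ) + (T' : ℂ) * I).im| := by simp [hT']
          _ ≤ ‖((u : ℂ) + (T' : ℂ) * I)‖ := Complex.abs_im_le_norm _
      calc ‖riemannZeta w₁‖ = ‖(riemannZeta w₁ - 1 / (w₁ - 1)) + 1 / (w₁ - 1)‖ := by ring_nf
        _ ≤ ‖riemannZeta w₁ - 1 / (w₁ - 1)‖ + ‖(1 : ℂ) / (w₁ - 1)‖ := norm_add_le _ _
        _ ≤ C * ℓ + 1 := add_le_add hsub₁ h1
        _ = 1 + C * ℓ := by ring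
    set w₂ : ℂ := 1 + ((u : ℂ) + (T' : ℂ) * I) - βj with hw₂
    have hw₂1 : w₂ ≠ 1 := by
      intro h; have := congrArg Complex.im h; simp [hw₂, hβjim] at this
      have : |T'| ≤ 1 := by rw [show T' = b by linarith]; exact hb
      linarith
    have hw₂im : |w₂.im| ≤ H + 2 := by
      have : w₂.im = T' - b := by simp [hw₂, hβjim]
      rw [this]
      calc |T' - b| ≤ |T'| + |b| := abs_sub _ _
        _ ≤ H + 1 := by rw [hT']; linarith
        _ ≤ H + 2 := by linarith
    have hw₂re : 1 - 2 * η ≤ w₂.re := by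
      have : w₂.re = 1 + u := by simp [hw₂, hβjre]
      rw [this]; linarith
    obtain ⟨-, -, hinv₂⟩ := hzfr_of w₂ hw₂1 hw₂im hw₂re
    exact mul_le_mul hnum hinv₂ (norm_nonneg _) (by positivity)
  refine ⟨⟨hη0, hη1⟩, hζ₁U, ?_, ?_, ?_, ?_, ?_⟩
  · intro z hz hζ; have h := hΦdiff z hz hζ; rw [hΦdef] at h; exact h
  · have h := hΦcont; rw [hΦdef] at h; exact h
  · intro t; have h := hΦ₀ t; rw [hΦdef] at h; exact h
  · intro t ht; have h := hΦ₁ t ht; rw [hΦdef] at h; exact h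
  · intro u hu1 hu2 T' hT'; have h := hΦ₂ u hu1 hu2 T' hT'; rw [hΦdef] at h; exact h

end Literature.NumberTheory.LFunctions.Zhang2022.AppendixBVarrho
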